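import Summits.Parity.GeneralizedHardyLittlewood.Theorems.PrimeLevelFamEdgeMomentsBeyondDiagonalDiagRemMomentsParam
import Summits.Parity.GeneralizedHardyLittlewood.Theorems.PrimeLevelFamEdgeMomentsBeyondDiagonalDiagRemMomentTailBoundPow
import HarnessLib

/-!
# Route `PrimeLevelFamEdge`, crux K_A `MomentsBeyondDiagonal` (stmt-Parity-20007), line «petersson_layers» v4, stub `stub_diag`:
# **the both-sided moment families of the GENERIC order: ONE constant for all decorations `S_t ⊗ S_{t′}`, `t, t′ ≤ s`**
# (brick (R5) of the generic remainder estimate (R_ij), census `Cruxes/MomentsBeyondDiagonal/Lines/petersson_layers_stub_diag_g19_generic_assembly.md`)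

In the remainder weight of order `(i,j)` (the `rem_ij` of `…DiagGenericAssembly.selbergOrder_split`) every kernel `r_ab(αk₁k₂)` is
decorated by the divisor moments `S_t(k₁)S_{t′}(k₂)`, `S_t(k) = Σ_{de=k}(log d − log e)^t`, `t + t′ ≤ i + j` (`S₀ = τ`). The per-order
files proved one family bound per decoration (`…DiagRemFourFourFamilies`, nine named envelopes); here, for every `s` and every
log-saving exponent `A`, the tail constants of «DRTAIL»_t (`…DiagRemMomentTailBoundPow.abs_sum_Wn_logDiff_pow_sub_le_pow t A`,
`t ≤ s`) are summed into ONE constant and fed to the parametric both-sided monomial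
`…DiagRemMomentsParam.abs_bothsided_moments_le_pow_of`, giving ONE envelope for all `(t,t′)`, `t, t′ ≤ s`, and for EVERY abstract
kernel `R` with two-sequence data `(C₀, N)` and pointwise data `(C₀, M ≤ N)`:

* `families_gen s A` — **∃ `K ≥ 0` (depending on `s, A` only): for all such `R` and all `t, t′ ≤ s`, `n ≥ 1`, `Y ≥ 1`, `α > 0`,
  `2αK₁Y ≤ 1`, `i, j ≥ 1`:
  `|Σ_{k₁,k₂≤Y} W_n(k₁)W_n(k₂)ℓ⁺(k₁)ⁱℓ⁺(k₂)ʲ·(S_t(k₁)S_{t′}(k₂)R(αk₁k₂))| ≤ logⁱ⁺ʲY·C₀·(K·D(n)²·(1+log Y)^{s+2})·(√(2αK₁Y) + x^N/(1+log K₁)^A)`**,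
  `x = 1+|log 2αY²|`, `W_n(k) = [(k,n)=1]W(k)`, `D = divWeight` — the family hypothesis of `…DiagGenericRemFamily.fam_Lpow` with
  `a = W_n`, `D₁ = S_t`, `D₂ = S_{t′}`.

Def-free; theorems only. Helper `--supports stmt-Parity-20007`; closes nothing; K_A, K_B and the Parity summit are NOT proved;
nothing about Landau–Siegel zeros.

## References
* E. Kowalski, P. Michel, J. VanderKam, J. reine angew. Math. 526 (2000), Prop. 5.1 p. 18.
  [cite: KowalskiMichelVanderKam2000, Prop. 5.1 — derivation (decorated remainder monomials of the diagonal, every order)]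
-/

noncomputable section

open Real Finset

namespace Summit.Parity.GeneralizedHardyLittlewood.Theorems.MomentsBeyondDiagonal.DiagCorner

open Literature.NumberTheory.LFunctions.KMV2000.MollifierMainTerm (W)
open Summit.Parity.GeneralizedHardyLittlewood.Theorems.BeyondDiagonalBeatsQuarter.KernelFormXSq
  (divWeight divWeight_nonneg one_le_divWeight)
open Summit.Parity.GeneralizedHardyLittlewood.Theorems.BeyondDiagonalBeatsQuarter.Corner

/-- Envelope arithmetic of `families_gen`: the constant of `abs_bothsided_moments_le_pow_of` with `C₁ = C₂ = C`, `u_t, u_{t′} ≤ u`,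
`u ≥ 1`, `D ≥ 1`, is below `28(C + C²)·D²·u` in both terms. [folklore] -/
theorem families_envelope_aux {C D u ut ut' sq T C₀ : ℝ} (hC : 0 ≤ C) (hD : 1 ≤ D) (hu : 1 ≤ u) (hut0 : 0 ≤ ut)
    (hut : ut ≤ u) (hut'0 : 0 ≤ ut') (hut' : ut' ≤ u) (hsq : 0 ≤ sq) (hT : 0 ≤ T) (hC₀ : 0 ≤ C₀) :
    C₀ * ((6 * (C * D) * (ut + C * D) + 3 * (C * D) * (ut' + C * D) + (C * D) * (C * D)) * sq +
        (18 * ut' * (C * D) + 19 * ((C * D) * (C * D))) * T) ≤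
      C₀ * (28 * (C + C ^ 2) * D ^ 2 * u) * (sq + T) := by
  have hD0 : 0 ≤ D := zero_le_one.trans hD
  have hDD : D ≤ D ^ 2 := by nlinarith
  have hX0 : 0 ≤ C * D := mul_nonneg hC hD0
  have hXle : C * D ≤ C * D ^ 2 := mul_le_mul_of_nonneg_left hDD hC
  have hCD2 : 0 ≤ C * D ^ 2 := by positivity
  have hu0 : 0 ≤ u := zero_le_one.trans hu
  -- first coefficient
  have p1 : 6 * (C * D) * (ut + C * D) + 3 * (C * D) * (ut' + C * D) + (C * D) * (C * D) ≤
      28 * (C + C ^ 2) * D ^ 2 * u := by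
    have e1 : (C * D) * ut ≤ (C * D ^ 2) * u := mul_le_mul hXle hut hut0 hCD2
    have e2 : (C * D) * ut' ≤ (C * D ^ 2) * u := mul_le_mul hXle hut' hut'0 hCD2
    have e3 : (C * D) * (C * D) ≤ (C ^ 2 * D ^ 2) * u := by
      have : (C * D) * (C * D) = (C ^ 2 * D ^ 2) * 1 := by ring
      rw [this]; exact mul_le_mul_of_nonneg_left hu (by positivity)
    nlinarith [mul_nonneg hC (mul_nonneg (sq_nonneg D) hu0), mul_nonneg (sq_nonneg C) (mul_nonneg (sq_nonneg D) hu0)]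
  -- second coefficient
  have p2 : 18 * ut' * (C * D) + 19 * ((C * D) * (C * D)) ≤ 28 * (C + C ^ 2) * D ^ 2 * u := by
    have e2 : (C * D) * ut' ≤ (C * D ^ 2) * u := mul_le_mul hXle hut' hut'0 hCD2
    have e3 : (C * D) * (C * D) ≤ (C ^ 2 * D ^ 2) * u := by
      have : (C * D) * (C * D) = (C ^ 2 * D ^ 2) * 1 := by ring
      rw [this]; exact mul_le_mul_of_nonneg_left hu (by positivity)
    nlinarith [mul_nonneg hC (mul_nonneg (sq_nonneg D) hu0), mul_nonneg (sq_nonneg C) (mul_nonneg (sq_nonneg D) hu0)]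
  have hK0 : 0 ≤ 28 * (C + C ^ 2) * D ^ 2 * u := by positivity
  calc _ ≤ C₀ * ((28 * (C + C ^ 2) * D ^ 2 * u) * sq + (28 * (C + C ^ 2) * D ^ 2 * u) * T) := by
        apply mul_le_mul_of_nonneg_left _ hC₀
        exact add_le_add (mul_le_mul_of_nonneg_right p1 hsq) (mul_le_mul_of_nonneg_right p2 hT)
    _ = _ := by ring

set_option maxHeartbeats 3200000 in
/-- **The both-sided moment families of the generic order under ONE constant** (module docstring).
[cite: KowalskiMichelVanderKam2000, Prop. 5.1 — derivation (decorated remainder monomials of the diagonal, every order)] -/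
theorem families_gen (s A : ℕ) : ∃ K : ℝ, 0 ≤ K ∧
    ∀ (N M : ℕ), M ≤ N → ∀ (C₀ : ℝ), 0 ≤ C₀ → ∀ (R : ℝ → ℝ),
      (∀ (a₁ a₂ : ℕ → ℝ) (Y α B η : ℝ) (K₁ i j : ℕ), 1 ≤ Y → 0 < α → 1 ≤ i → 1 ≤ j →
      (∀ e : ℕ, e ≤ ⌊Y⌋₊ → |∑ k ∈ Icc 1 e, a₂ k| ≤ B) → (∀ e : ℕ, K₁ ≤ e → |∑ k ∈ Icc 1 e, a₁ k| ≤ η) →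
      2 * α * K₁ * Y ≤ 1 →
    |∑ k₁ ∈ Icc 1 ⌊Y⌋₊, ∑ k₂ ∈ Icc 1 ⌊Y⌋₊,
        a₁ k₁ * a₂ k₂ * ellp Y k₁ ^ i * ellp Y k₂ ^ j * R (α * k₁ * k₂)| ≤
      (∑ k ∈ Icc 1 ⌊Y⌋₊, |a₁ k| * ellp Y k ^ i) * (B * (Real.log Y ^ j * (3 * C₀ * Real.sqrt (2 * α * K₁ * Y)))) +
        (∑ k ∈ Icc 1 ⌊Y⌋₊, |a₂ k| * ellp Y k ^ j) *
          ((2 * η) * (Real.log Y ^ i * (9 * C₀ * (1 + |Real.log (2 * α * Y ^ 2)|) ^ N)))) →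
      (∀ y : ℝ, 0 < y → y ≤ 1 → |R y| ≤ C₀ * Real.sqrt y) → (∀ y : ℝ, 1 ≤ y → |R y| ≤ C₀ * (1 + Real.log y) ^ M) →
    ∀ t t' : ℕ, t ≤ s → t' ≤ s → ∀ n : ℕ, n ≠ 0 → ∀ (Y α : ℝ) (K₁ i j : ℕ), 1 ≤ Y → 0 < α → 1 ≤ i → 1 ≤ j →
      2 * α * K₁ * Y ≤ 1 →
    |∑ k₁ ∈ Icc 1 ⌊Y⌋₊, ∑ k₂ ∈ Icc 1 ⌊Y⌋₊,
        (if k₁.Coprime n then W k₁ else 0) * (if k₂.Coprime n then W k₂ else 0) * ellp Y k₁ ^ i * ellp Y k₂ ^ j *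
          ((∑ x ∈ k₁.divisorsAntidiagonal, (Real.log x.1 - Real.log x.2) ^ t) * (∑ x ∈ k₂.divisorsAntidiagonal, (Real.log x.1 - Real.log x.2) ^ t') * R (α * k₁ * k₂))| ≤
      Real.log Y ^ (i + j) * (C₀ * (K * divWeight n ^ 2 * (1 + Real.log Y) ^ (s + 2)) *
        (Real.sqrt (2 * α * K₁ * Y) + (1 + |Real.log (2 * α * Y ^ 2)|) ^ N / (1 + Real.log K₁) ^ A)) := by
  classical
  choose C hC0 hC using fun t : ℕ ↦ abs_sum_Wn_logDiff_pow_sub_le_pow t A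
  set CT : ℝ := ∑ t ∈ Finset.range (s + 1), C t with hCT
  have hCT0 : 0 ≤ CT := Finset.sum_nonneg fun t _ ↦ hC0 t
  have hCle : ∀ t : ℕ, t ≤ s → C t ≤ CT := fun t ht ↦
    Finset.single_le_sum (fun t _ ↦ hC0 t) (Finset.mem_range.2 (Nat.lt_succ_of_le ht))
  refine ⟨28 * (CT + CT ^ 2), by positivity,
    fun N M hMN C₀ hC₀ R hR2 hRs hRt t t' ht ht' n hn Y α K₁ i j hY hα hi hj hY₁ ↦ ?_⟩
  -- «DRTAIL» with the common constant
  have htail : ∀ r : ℕ, r ≤ s → ∀ n : ℕ, n ≠ 0 → ∃ c : ℝ, |c| ≤ CT * divWeight n ∧ ∀ y : ℝ, 1 ≤ y →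
      |(∑ k ∈ Icc 1 ⌊y⌋₊, (if k.Coprime n then W k else 0) *
          ∑ z ∈ k.divisorsAntidiagonal, (Real.log z.1 - Real.log z.2) ^ r) - c| ≤ CT * divWeight n / (1 + Real.log y) ^ A := by
    intro r hr n hn
    obtain ⟨c, hc, hcy⟩ := hC r n hn
    have hD := divWeight_nonneg n
    have hle : C r * divWeight n ≤ CT * divWeight n := mul_le_mul_of_nonneg_right (hCle r hr) hD
    refine ⟨c, hc.trans hle, fun y hy ↦ (hcy y hy).trans ?_⟩
    exact div_le_div_of_nonneg_right hle (pow_nonneg (by linarith [Real.log_nonneg hy]) A)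
  have key := abs_bothsided_moments_le_pow_of t t' A hCT0 hCT0 (htail t ht) (htail t' ht') hMN hC₀ hR2 hRs hRt
    n hn Y α K₁ i j hY hα hi hj hY₁
  -- reshape the summand
  have hsum : ∑ k₁ ∈ Icc 1 ⌊Y⌋₊, ∑ k₂ ∈ Icc 1 ⌊Y⌋₊,
        (if k₁.Coprime n then W k₁ else 0) * (if k₂.Coprime n then W k₂ else 0) * ellp Y k₁ ^ i * ellp Y k₂ ^ j *
          ((∑ x ∈ k₁.divisorsAntidiagonal, (Real.log x.1 - Real.log x.2) ^ t) * (∑ x ∈ k₂.divisorsAntidiagonal, (Real.log x.1 - Real.log x.2) ^ t') * R (α * k₁ * k₂)) =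
      ∑ k₁ ∈ Icc 1 ⌊Y⌋₊, ∑ k₂ ∈ Icc 1 ⌊Y⌋₊,
        ((if k₁.Coprime n then W k₁ else 0) * ∑ x ∈ k₁.divisorsAntidiagonal, (Real.log x.1 - Real.log x.2) ^ t) *
          ((if k₂.Coprime n then W k₂ else 0) * ∑ x ∈ k₂.divisorsAntidiagonal, (Real.log x.1 - Real.log x.2) ^ t') *
            ellp Y k₁ ^ i * ellp Y k₂ ^ j * R (α * k₁ * k₂) :=
    Finset.sum_congr rfl fun k₁ _ ↦ Finset.sum_congr rfl fun k₂ _ ↦ by ring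
  rw [hsum]
  refine key.trans ?_
  -- envelope arithmetic
  have hLY0 : 0 ≤ Real.log Y := Real.log_nonneg hY
  have hu1 : 1 ≤ 1 + Real.log Y := by linarith
  have hut : (1 + Real.log Y) ^ (t + 2) ≤ (1 + Real.log Y) ^ (s + 2) := pow_le_pow_right₀ hu1 (by omega)
  have hut' : (1 + Real.log Y) ^ (t' + 2) ≤ (1 + Real.log Y) ^ (s + 2) := pow_le_pow_right₀ hu1 (by omega)
  have h := families_envelope_aux (sq := Real.sqrt (2 * α * K₁ * Y))
    (T := (1 + |Real.log (2 * α * Y ^ 2)|) ^ N / (1 + Real.log K₁) ^ A) hCT0 (one_le_divWeight hn) (one_le_pow₀ hu1)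
    (by positivity) hut (by positivity) hut' (Real.sqrt_nonneg _)
    (div_nonneg (pow_nonneg (by positivity) N) (pow_nonneg (by linarith [Real.log_natCast_nonneg K₁]) A)) hC₀
  refine mul_le_mul_of_nonneg_left (le_trans (le_of_eq ?_) h) (pow_nonneg hLY0 _)
  ring

end Summit.Parity.GeneralizedHardyLittlewood.Theorems.MomentsBeyondDiagonal.DiagCorner

end
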